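import Literature.Geometry.Symplectic.KahlerDecomposition
import Literature.Geometry.Symplectic.SteinSeamForms
import Literature.Topology.FourManifolds.GluingIsotopyProofs
import HarnessLib

/-!
# Kähler decomposition: isotopic contact seams can be matched pointwise (Baykur 2006, Thm. 5.1,
# "isotopic" ⇒ the tree's pointwise rendering), and doubles of Stein domains (§6, Example 2)

Sibling (proofs) file of `KahlerDecomposition.lean` (the named fact
`Literature.Geometry.Symplectic.baykur_kahlerDecomposition`, Baykur 2006, Thm. 5.1) next to
`KahlerDecompositionSphere.lean` (the model case `S⁴ = B⁴ ∪ B̄⁴`).  Everything here is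
**proved**; no definitions, no named facts.

## What is proved

The printed theorem says (AGT 6 (2006), Thm. 5.1, p. 1252): *"`X₊` and `−X₋` are both compact
Stein manifolds with strictly pseudoconvex boundaries.  These Stein structures can be chosen so
that the induced contact structures `ξ₊` on `∂X₊` and `ξ₋` on `−∂X₋` are **isotopic**"*, and
the author summarises (p. 1240): *"we conclude that the Stein structures can be chosen to agree
on the common contact boundary"*; the tree renders the conclusion POINTWISE (the differential of
`b₂.incl ∘ ψ` carries `ξ₊` onto `ξ₋` at every point of the seam; `KahlerDecomposition.lean`,
"Deviations", item 1, where the passage isotopic ⇒ pointwise is justified in prose by Gray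
stability and a collar twist).  This file PROVES that passage in the vocabulary of the tree:

* `exists_matching_gluing_of_isDiffeotopicToId` — **isotopic seams can be matched.**  Let
  `X = W₁ ∪_ψ W₂` (`IsBoundaryGluing b₁ b₂ ψ (𝓡 4) X`) and let `χ` be a self-diffeomorphism of
  the abstract boundary `∂W₂ = b₂.carrier` *diffeotopic to the identity*
  (`Literature.Topology.FourManifolds.Diffeomorph.IsDiffeotopicToId`: the time-one map of an
  isotopy `χ_t` of `∂W₂`, `χ₀ = id` — Geiges 2008, §2.2: contact structures `ξ`, `ξ'` on a
  closed manifold are *isotopic* when `Tχ₁(ξ) = ξ'` for such an isotopy, the conclusion of Gray's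
  Thm. 2.2.2) carrying the transported plane field
  `ψ_* ξ₁` onto `ξ₂` (`ξᵢ = boundaryPlaneField Jᵢ bᵢ`, the complex tangencies pulled back to the
  abstract boundaries).  Then `X` is ALSO the gluing `W₁ ∪_{χ ∘ ψ} W₂`, and along the new gluing
  map the plane fields match pointwise:
  `d(b₂.incl ∘ χ ∘ ψ)(ξ₁) = contactPlane J₂` at every point.  Proof, as in Hirsch,
  *Differential Topology* (1976), Ch. 8 §2, Thm. 2.3 ("isotopic gluing maps give diffeomorphic
  manifolds", here in the sharper relational form "the same `X` is also a `χ ∘ ψ`-gluing"):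
  `χ⁻¹` is diffeotopic to the identity, spreads over a collar of `∂W₂` to a self-diffeomorphism
  `Φ` of `W₂` with `Φ ∘ incl = incl ∘ χ⁻¹`
  (`BoundaryData.exists_diffeomorph_comp_incl_eq_of_isDiffeotopicToId_euclidean`,
  `GluingIsotopyProofs.lean`: collar theorem + slide extension, both proved in the tree), and
  precomposing the embedding of `W₂` with `Φ` re-glues (`IsBoundaryGluing.comp_diffeomorph_right`,
  Hirsch's Thm. 2.2); the contact matching is the chain rule plus
  `map_mfderiv_boundaryDataIncl_boundaryPlaneField` below.
* `exists_matching_gluing_of_ambientIsotopy` — the same with the isotopy given as an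
  `AmbientIsotopy` of `∂W₂` (the output type of the tree's Gray-stability fact
  `Literature.Geometry.Symplectic.GrayStability`), via `AmbientIsotopy.isDiffeotopicToId`
  (`DiffeotopyProofs.lean`).
* `baykur_kahlerDecomposition_of_isotopic` — hence **the print-literal form of Thm. 5.1 implies
  the tree's rendering** `baykur_kahlerDecomposition`: if every closed connected oriented smooth
  4-manifold is a gluing `W₁ ∪_ψ W₂` of two compact Stein domains whose induced contact
  structures on the seam are isotopic (an ambient isotopy of `∂W₂` carrying `ψ_* ξ₁` onto
  `ξ₂`), then `baykur_kahlerDecomposition` holds.  So the tree's statement is not stronger than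
  what Baykur proves.

On the way, the boundary differential topology behind the matching clause, for an arbitrary
field of endomorphisms `J` and arbitrary boundary data (the sphere file proved it for `∂B⁴` by an
ambient computation):

* `range_mfderiv_boundaryDataIncl` — **`range d(b.incl)_z = T_{b.incl z}∂W`**, the equality
  form of the tree's `mfderiv_apply_mem_boundaryTangentSpace` / `exists_mfderiv_incl_eq`
  (`SteinSeamForms.lean`: maps into `∂W` are tangent to it, by Fermat on the normal coordinate;
  the inclusion of a boundary datum is an immersion and `dim T∂W = 3`);
* `contactPlane_le_range_mfderiv_boundaryDataIncl`,
  `map_mfderiv_boundaryDataIncl_boundaryPlaneField` — `ξ ≤ range d(b.incl)` and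
  **`d(b.incl)_z (b.incl^* ξ)_z = ξ_{b.incl z}`**: the matching clause of the fact for the
  identity gluing map;
* `map_mfderiv_boundaryDataIncl_comp` — chain rule for plane fields along `b.incl ∘ g`.

And Baykur's first family of examples (§6, Example 2, p. 1262: *"The easiest examples are
doubles.  If `Y⁴` is a compact Kähler manifold with strictly pseudoconvex boundary, then
`X = Y ∪ −Y` is equipped with a folded Kähler structure.  When `Y` is indeed Stein, we get a
nicely folded structure"*):

* `baykur_conclusion_of_isDouble` — **every double `D(W) = W ∪_{id} W` of a compact
  Stein domain satisfies the conclusion of `baykur_kahlerDecomposition`** (same Stein structure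
  on both halves, identity gluing map; the matching clause is
  `map_mfderiv_boundaryDataIncl_boundaryPlaneField`);
* `exists_isDouble_and_baykur_conclusion` — every compact Stein domain HAS such a double
  (existence of gluings, `exists_isBoundaryGluing_holds`, `GluingProofs.lean`), so the
  conclusion of the fact is realised with prescribed halves `W₁ = W₂ = W` for every `W`.

## References

* R. İ. Baykur, *Kähler decomposition of 4-manifolds*, Algebr. Geom. Topol. 6 (2006) 1239–1265
  (arXiv:math/0601396), Thm. 5.1, p. 1240, §6 Example 2. [Baykur2006]
* M. W. Hirsch, *Differential Topology*, GTM 33 (1976), Ch. 8 §2, Thms. 2.2–2.3 (re-gluing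
  through a diffeomorphism of one piece; isotopic gluing maps). [HirschDT1976]
* H. Geiges, *An Introduction to Contact Topology*, CUP (2008), §2.2 (isotopic contact
  structures, Gray stability Thm. 2.2.2). [Geiges2008]
-/

noncomputable section

open scoped Manifold ContDiff Topology
open Set Function

namespace Literature.Geometry.Symplectic

open Literature.Topology.FourManifolds

universe u

/-! ### The differential of a boundary inclusion maps onto the boundary hyperplane -/

section BoundaryDifferential

variable {W : Type u} [TopologicalSpace W] [ChartedSpace (EuclideanHalfSpace 4) W]

/-- **Chain rule for plane fields along `b.incl ∘ g`**: for a smooth map `g` from a 3-manifold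
into the abstract boundary, `d(b.incl ∘ g)_z V = d(b.incl)_{g z} (dg_z V)` for every subspace
`V`. [folklore] -/
theorem map_mfderiv_boundaryDataIncl_comp (b : BoundaryData (𝓡∂ 4) W (𝓡 3)) {N : Type*}
    [TopologicalSpace N] [ChartedSpace (EuclideanSpace ℝ (Fin 3)) N] {g : N → b.carrier}
    (hg : ContMDiff (𝓡 3) (𝓡 3) ∞ g) (z : N) (V : Submodule ℝ (EuclideanSpace ℝ (Fin 3))) :
    Submodule.map (mfderiv (𝓡 3) (𝓡∂ 4) (b.incl ∘ g) z).toLinearMap V =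
      Submodule.map (mfderiv (𝓡 3) (𝓡∂ 4) b.incl (g z)).toLinearMap
        (Submodule.map (mfderiv (𝓡 3) (𝓡 3) g z).toLinearMap V) := by
  have hι : MDifferentiableAt (𝓡 3) (𝓡∂ 4) b.incl (g z) :=
    b.isSmoothEmbedding.contMDiff.mdifferentiableAt (by simp)
  have hgz : MDifferentiableAt (𝓡 3) (𝓡 3) g z := hg.mdifferentiableAt (by simp)
  have e := mfderiv_comp z hι hgz
  rw [← Submodule.map_comp]
  exact congrArg (fun T : TangentSpace (𝓡 3) z →L[ℝ] TangentSpace (𝓡∂ 4) (b.incl (g z)) =>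
    Submodule.map T.toLinearMap V) e

variable [IsManifold (𝓡∂ 4) ∞ W]

/-- **`range d(b.incl)_z = T∂W`: the differential of the inclusion of a boundary datum maps ONTO
the boundary hyperplane** — the equality form of `mfderiv_apply_mem_boundaryTangentSpace` (its
range lies in `T∂W`) and `exists_mfderiv_incl_eq` (every boundary tangent vector is attained: a
smooth embedding is an immersion and `dim T∂W = 3`), both `SteinSeamForms.lean`. [folklore] -/
theorem range_mfderiv_boundaryDataIncl (b : BoundaryData (𝓡∂ 4) W (𝓡 3)) (z : b.carrier) :
    LinearMap.range (mfderiv (𝓡 3) (𝓡∂ 4) b.incl z).toLinearMap = boundaryTangentSpace := by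
  refine le_antisymm ?_ fun v hv => ?_
  · rintro v ⟨u, rfl⟩
    exact mfderiv_apply_mem_boundaryTangentSpace b.incl (b.incl_mem_boundary z) u
  · obtain ⟨u, hu⟩ := exists_mfderiv_incl_eq b z hv
    exact ⟨u, hu⟩

/-- **`ξ ≤ range d(b.incl)`**: the complex tangencies `contactPlane J (b.incl z) ≤ T∂W` of any
field of endomorphisms `J` lie in the range of the differential of the boundary inclusion.
[folklore] -/
theorem contactPlane_le_range_mfderiv_boundaryDataIncl
    (J : (x : W) → ((EuclideanSpace ℝ (Fin 4)) →L[ℝ] (EuclideanSpace ℝ (Fin 4))))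
    (b : BoundaryData (𝓡∂ 4) W (𝓡 3)) (z : b.carrier) :
    contactPlane J (b.incl z) ≤
      LinearMap.range (mfderiv (𝓡 3) (𝓡∂ 4) b.incl z).toLinearMap := by
  rw [range_mfderiv_boundaryDataIncl]
  exact contactPlane_le_boundaryTangentSpace J _

/-- **`d(b.incl)_z (b.incl^* ξ)_z = ξ_{b.incl z}`**: the differential of the boundary inclusion
carries the pulled-back plane field `boundaryPlaneField J b` (`PlanarContactBoundary.lean`) ONTO
the complex tangencies `contactPlane J` — the contact-matching clause of
`baykur_kahlerDecomposition` for the identity gluing map, for every `J` and every boundary datum.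
[folklore] -/
theorem map_mfderiv_boundaryDataIncl_boundaryPlaneField
    (J : (x : W) → ((EuclideanSpace ℝ (Fin 4)) →L[ℝ] (EuclideanSpace ℝ (Fin 4))))
    (b : BoundaryData (𝓡∂ 4) W (𝓡 3)) (z : b.carrier) :
    Submodule.map (mfderiv (𝓡 3) (𝓡∂ 4) b.incl z).toLinearMap (boundaryPlaneField J b z) =
      contactPlane J (b.incl z) :=
  Submodule.map_comap_eq_self (contactPlane_le_range_mfderiv_boundaryDataIncl J b z)

/-- **Matching along a plane-field-preserving map of the seam.**  If a smooth map
`g : ∂W₁ → ∂W₂` of abstract boundaries carries the plane field `ξ₁ = b₁.incl^* ξ_{J₁}` onto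
`ξ₂ = b₂.incl^* ξ_{J₂}` (`dg_z (ξ₁)_z = (ξ₂)_{g z}`), then `d(b₂.incl ∘ g)` carries `ξ₁` onto the
complex tangencies `ξ_{J₂}` of `∂W₂` — the matching clause of `baykur_kahlerDecomposition` for
the gluing map `g`. [folklore] -/
theorem map_mfderiv_boundaryDataIncl_comp_boundaryPlaneField
    {W₁ : Type*} [TopologicalSpace W₁] [ChartedSpace (EuclideanHalfSpace 4) W₁]
    (J₁ : (x : W₁) → ((EuclideanSpace ℝ (Fin 4)) →L[ℝ] (EuclideanSpace ℝ (Fin 4))))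
    (J₂ : (x : W) → ((EuclideanSpace ℝ (Fin 4)) →L[ℝ] (EuclideanSpace ℝ (Fin 4))))
    (b₁ : BoundaryData (𝓡∂ 4) W₁ (𝓡 3)) (b₂ : BoundaryData (𝓡∂ 4) W (𝓡 3))
    {g : b₁.carrier → b₂.carrier} (hg : ContMDiff (𝓡 3) (𝓡 3) ∞ g)
    (hξ : ∀ z, Submodule.map (mfderiv (𝓡 3) (𝓡 3) g z).toLinearMap (boundaryPlaneField J₁ b₁ z) =
      boundaryPlaneField J₂ b₂ (g z)) (z : b₁.carrier) :
    Submodule.map (mfderiv (𝓡 3) (𝓡∂ 4) (b₂.incl ∘ g) z).toLinearMap (boundaryPlaneField J₁ b₁ z) =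
      contactPlane J₂ (b₂.incl (g z)) := by
  rw [map_mfderiv_boundaryDataIncl_comp b₂ hg z, hξ z,
    map_mfderiv_boundaryDataIncl_boundaryPlaneField]

end BoundaryDifferential

/-! ### Isotopic seams can be matched pointwise (Hirsch's Thm. 2.3 in relational form) -/

section IsotopicSeam

variable {W₁ : Type u} [TopologicalSpace W₁] [ChartedSpace (EuclideanHalfSpace 4) W₁]
  {W₂ : Type u} [TopologicalSpace W₂] [ChartedSpace (EuclideanHalfSpace 4) W₂]
  [IsManifold (𝓡∂ 4) ∞ W₂] [CompactSpace W₂]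
  {X : Type*} [TopologicalSpace X] [ChartedSpace (EuclideanSpace ℝ (Fin 4)) X]

/-- **Re-gluing along a twist diffeotopic to the identity.**  If `X = W₁ ∪_ψ W₂` (`W₂` compact,
`X` Hausdorff) and `χ ∈ Diff ∂W₂` is diffeotopic to the identity, then `X` is also the gluing
`W₁ ∪_{χ ∘ ψ} W₂`: `χ⁻¹` is diffeotopic to the identity, spreads over a collar of `∂W₂` to a
self-diffeomorphism `Φ` of `W₂` with `Φ ∘ incl = incl ∘ χ⁻¹`
(`BoundaryData.exists_diffeomorph_comp_incl_eq_of_isDiffeotopicToId_euclidean`), and one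
re-glues through `Φ` (`IsBoundaryGluing.comp_diffeomorph_right`).  Hirsch, *Differential
Topology* (1976), Ch. 8 §2, proof of Thm. 2.3. [cite: HirschDT1976, Ch. 8 §2, Thm. 2.3] -/
theorem isBoundaryGluing_trans_of_isDiffeotopicToId [T2Space X]
    {b₁ : BoundaryData (𝓡∂ 4) W₁ (𝓡 3)} {b₂ : BoundaryData (𝓡∂ 4) W₂ (𝓡 3)}
    {ψ : b₁.carrier ≃ₘ⟮𝓡 3, 𝓡 3⟯ b₂.carrier} (hglue : IsBoundaryGluing b₁ b₂ ψ (𝓡 4) X)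
    {χ : b₂.carrier ≃ₘ⟮𝓡 3, 𝓡 3⟯ b₂.carrier} (hχ : Diffeomorph.IsDiffeotopicToId χ) :
    IsBoundaryGluing b₁ b₂ (ψ.trans χ) (𝓡 4) X := by
  -- `W₂` embeds in the Hausdorff `X`, hence is Hausdorff
  haveI : T2Space W₂ := by
    obtain ⟨-, jB, -, hB, -, -⟩ := hglue
    exact hB.isEmbedding.t2Space
  obtain ⟨Φ, hΦ⟩ :=
    b₂.exists_diffeomorph_comp_incl_eq_of_isDiffeotopicToId_euclidean (n := 3) hχ.symm
  exact hglue.comp_diffeomorph_right Φ χ.symm.toEquiv (fun w => congrFun hΦ w) fun z => by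
    simp

/-- **Isotopic seams can be matched (diffeotopy form).**  Let `X = W₁ ∪_ψ W₂` be a gluing of two
4-manifolds with boundary (`W₂` compact, `X` Hausdorff), `J₁`, `J₂` fields of endomorphisms of
`TW₁`, `TW₂` with boundary plane fields `ξᵢ = boundaryPlaneField Jᵢ bᵢ` on the abstract
boundaries, and let `χ ∈ Diff ∂W₂` be diffeotopic to the identity with `d(χ ∘ ψ)(ξ₁) = ξ₂`
pointwise (the contact structures `ψ_* ξ₁` and `ξ₂` on `∂W₂` are *isotopic*, Geiges 2008, §2.2).
Then along the gluing map `χ ∘ ψ` — for which `X` is still the gluing `W₁ ∪_{χ ∘ ψ} W₂`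
(`isBoundaryGluing_trans_of_isDiffeotopicToId`) — the plane field `ξ₁` is carried ONTO the
complex tangencies of `∂W₂` at every point.  This is the passage "isotopic ⇒ all data match on
the hypersurface" of Baykur's Thm. 5.1 / p. 1240, by Hirsch's Thm. 2.3.
[cite: Baykur2006, Thm. 5.1 and p. 1240; HirschDT1976, Ch. 8 §2, Thm. 2.3] -/
theorem exists_matching_gluing_of_isDiffeotopicToId [T2Space X]
    (J₁ : (x : W₁) → ((EuclideanSpace ℝ (Fin 4)) →L[ℝ] (EuclideanSpace ℝ (Fin 4))))
    (J₂ : (x : W₂) → ((EuclideanSpace ℝ (Fin 4)) →L[ℝ] (EuclideanSpace ℝ (Fin 4))))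
    (b₁ : BoundaryData (𝓡∂ 4) W₁ (𝓡 3)) (b₂ : BoundaryData (𝓡∂ 4) W₂ (𝓡 3))
    {ψ : b₁.carrier ≃ₘ⟮𝓡 3, 𝓡 3⟯ b₂.carrier} (hglue : IsBoundaryGluing b₁ b₂ ψ (𝓡 4) X)
    {χ : b₂.carrier ≃ₘ⟮𝓡 3, 𝓡 3⟯ b₂.carrier} (hχ : Diffeomorph.IsDiffeotopicToId χ)
    (hξ : ∀ z, Submodule.map (mfderiv (𝓡 3) (𝓡 3) (χ ∘ ψ) z).toLinearMap
      (boundaryPlaneField J₁ b₁ z) = boundaryPlaneField J₂ b₂ (χ (ψ z))) :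
    (∀ z, Submodule.map (mfderiv (𝓡 3) (𝓡∂ 4) (b₂.incl ∘ (ψ.trans χ)) z).toLinearMap
        (boundaryPlaneField J₁ b₁ z) = contactPlane J₂ (b₂.incl ((ψ.trans χ) z))) ∧
      IsBoundaryGluing b₁ b₂ (ψ.trans χ) (𝓡 4) X := by
  refine ⟨fun z => ?_, isBoundaryGluing_trans_of_isDiffeotopicToId hglue hχ⟩
  rw [Diffeomorph.coe_trans]
  exact map_mfderiv_boundaryDataIncl_comp_boundaryPlaneField J₁ J₂ b₁ b₂
    (χ.contMDiff.comp ψ.contMDiff) hξ z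

/-- **Isotopic seams can be matched (ambient-isotopy form)** — the same with the isotopy of
`∂W₂` given as an `AmbientIsotopy` `Ψ` (`Ψ₀ = id`, the output of the tree's Gray-stability
fact `GrayStability`) whose time-one map carries `ψ_* ξ₁` onto `ξ₂`: the time-one map is
diffeotopic to the identity (`AmbientIsotopy.isDiffeotopicToId`).
[cite: Baykur2006, Thm. 5.1 and p. 1240; HirschDT1976, Ch. 8 §2, Thm. 2.3] -/
theorem exists_matching_gluing_of_ambientIsotopy [T2Space X]
    (J₁ : (x : W₁) → ((EuclideanSpace ℝ (Fin 4)) →L[ℝ] (EuclideanSpace ℝ (Fin 4))))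
    (J₂ : (x : W₂) → ((EuclideanSpace ℝ (Fin 4)) →L[ℝ] (EuclideanSpace ℝ (Fin 4))))
    (b₁ : BoundaryData (𝓡∂ 4) W₁ (𝓡 3)) (b₂ : BoundaryData (𝓡∂ 4) W₂ (𝓡 3))
    {ψ : b₁.carrier ≃ₘ⟮𝓡 3, 𝓡 3⟯ b₂.carrier} (hglue : IsBoundaryGluing b₁ b₂ ψ (𝓡 4) X)
    (Ψ : AmbientIsotopy (𝓡 3) b₂.carrier)
    (hξ : ∀ z, Submodule.map (mfderiv (𝓡 3) (𝓡 3) (Ψ.toFun 1 ∘ ψ) z).toLinearMap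
      (boundaryPlaneField J₁ b₁ z) = boundaryPlaneField J₂ b₂ (Ψ.toFun 1 (ψ z))) :
    ∃ ψ' : b₁.carrier ≃ₘ⟮𝓡 3, 𝓡 3⟯ b₂.carrier,
      (∀ z, Submodule.map (mfderiv (𝓡 3) (𝓡∂ 4) (b₂.incl ∘ ψ') z).toLinearMap
          (boundaryPlaneField J₁ b₁ z) = contactPlane J₂ (b₂.incl (ψ' z))) ∧
        IsBoundaryGluing b₁ b₂ ψ' (𝓡 4) X :=
  ⟨ψ.trans (Ψ.toDiffeomorph 1),
    exists_matching_gluing_of_isDiffeotopicToId J₁ J₂ b₁ b₂ hglue (Ψ.isDiffeotopicToId 1) hξ⟩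

end IsotopicSeam

/-! ### The print-literal form of Thm. 5.1 implies the tree's rendering -/

/-- **Baykur's Thm. 5.1 as printed ("`ξ₊` and `ξ₋` are isotopic") implies the tree's pointwise
rendering `baykur_kahlerDecomposition`.**  Hypothesis: every closed connected orientable smooth
4-manifold `X` is a gluing `W₁ ∪_ψ W₂` of two compact Stein domains such that the induced
contact structures on the seam are *isotopic* — there is an ambient isotopy `Ψ` of the abstract
boundary `∂W₂` whose time-one map carries `ψ_* ξ₁` (`ξ₁ = boundaryPlaneField S₁.J b₁`) onto
`ξ₂ = boundaryPlaneField S₂.J b₂` (Geiges 2008, §2.2: isotopic contact structures).  Conclusion: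
the named fact, whose matching clause is pointwise.  Proof:
`exists_matching_gluing_of_ambientIsotopy` (Hirsch's Thm. 2.3: re-glue along `Ψ₁ ∘ ψ`).  This
is item 1 of the "Deviations" of `KahlerDecomposition.lean`, proved.
[cite: Baykur2006, Thm. 5.1 and p. 1240] -/
theorem baykur_kahlerDecomposition_of_isotopic
    (H : ∀ (X : Type) [TopologicalSpace X] [T2Space X] [SecondCountableTopology X]
      [CompactSpace X] [ConnectedSpace X] [ChartedSpace (EuclideanSpace ℝ (Fin 4)) X]
      [IsManifold (𝓡 4) ∞ X],
      IsOrientable (𝓡 4) X →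
      ∃ (W₁ : Type) (_ : TopologicalSpace W₁) (_ : ChartedSpace (EuclideanHalfSpace 4) W₁)
        (_ : IsManifold (𝓡∂ 4) ∞ W₁) (_ : CompactSpace W₁)
        (W₂ : Type) (_ : TopologicalSpace W₂) (_ : ChartedSpace (EuclideanHalfSpace 4) W₂)
        (_ : IsManifold (𝓡∂ 4) ∞ W₂) (_ : CompactSpace W₂)
        (S₁ : SteinStructure W₁) (S₂ : SteinStructure W₂)
        (b₁ : BoundaryData (𝓡∂ 4) W₁ (𝓡 3)) (b₂ : BoundaryData (𝓡∂ 4) W₂ (𝓡 3))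
        (ψ : b₁.carrier ≃ₘ⟮𝓡 3, 𝓡 3⟯ b₂.carrier) (Ψ : AmbientIsotopy (𝓡 3) b₂.carrier),
        (∀ z, Submodule.map (mfderiv (𝓡 3) (𝓡 3) (Ψ.toFun 1 ∘ ψ) z).toLinearMap
            (boundaryPlaneField S₁.J b₁ z) = boundaryPlaneField S₂.J b₂ (Ψ.toFun 1 (ψ z))) ∧
          IsBoundaryGluing b₁ b₂ ψ (𝓡 4) X) :
    baykur_kahlerDecomposition := by
  intro X _ _ _ _ _ _ _ hO
  obtain ⟨W₁, t₁, c₁, m₁, k₁, W₂, t₂, c₂, m₂, k₂, S₁, S₂, b₁, b₂, ψ, Ψ, hξ, hglue⟩ := H X hO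
  obtain ⟨ψ', hψ', hglue'⟩ :=
    exists_matching_gluing_of_ambientIsotopy S₁.J S₂.J b₁ b₂ hglue Ψ hξ
  exact ⟨W₁, t₁, c₁, m₁, k₁, W₂, t₂, c₂, m₂, k₂, S₁, S₂, b₁, b₂, ψ', hψ', hglue'⟩

/-! ### Doubles of Stein domains (Baykur §6, Example 2) -/

section Doubles

variable {W : Type} [TopologicalSpace W] [ChartedSpace (EuclideanHalfSpace 4) W]
  [IsManifold (𝓡∂ 4) ∞ W] [CompactSpace W]

/-- **Every double `D(W) = W ∪_{id} W` of a compact Stein domain satisfies the conclusion of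
`baykur_kahlerDecomposition`** (Baykur 2006, §6 Example 2: *"The easiest examples are doubles …
When `Y` is indeed Stein, we get a nicely folded structure"*): both halves carry the same Stein
structure `S`, the gluing map is the identity of `∂W`, and the matching clause is
`map_mfderiv_boundaryDataIncl_boundaryPlaneField`. [cite: Baykur2006, §6 Example 2] -/
theorem baykur_conclusion_of_isDouble (S : SteinStructure W)
    (b : BoundaryData (𝓡∂ 4) W (𝓡 3)) {X : Type*} [TopologicalSpace X]
    [ChartedSpace (EuclideanSpace ℝ (Fin 4)) X] (h : IsDouble b (𝓡 4) X) :
    ∃ (W₁ : Type) (_ : TopologicalSpace W₁) (_ : ChartedSpace (EuclideanHalfSpace 4) W₁)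
      (_ : IsManifold (𝓡∂ 4) ∞ W₁) (_ : CompactSpace W₁)
      (W₂ : Type) (_ : TopologicalSpace W₂) (_ : ChartedSpace (EuclideanHalfSpace 4) W₂)
      (_ : IsManifold (𝓡∂ 4) ∞ W₂) (_ : CompactSpace W₂)
      (S₁ : SteinStructure W₁) (S₂ : SteinStructure W₂)
      (b₁ : BoundaryData (𝓡∂ 4) W₁ (𝓡 3)) (b₂ : BoundaryData (𝓡∂ 4) W₂ (𝓡 3))
      (ψ : b₁.carrier ≃ₘ⟮𝓡 3, 𝓡 3⟯ b₂.carrier),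
      (∀ z, Submodule.map (mfderiv (𝓡 3) (𝓡∂ 4) (b₂.incl ∘ ψ) z).toLinearMap
          (boundaryPlaneField S₁.J b₁ z) = contactPlane S₂.J (b₂.incl (ψ z))) ∧
        IsBoundaryGluing b₁ b₂ ψ (𝓡 4) X := by
  refine ⟨W, _, _, _, _, W, _, _, _, _, S, S, b, b, Diffeomorph.refl (𝓡 3) _ ∞, ?_, ?_⟩
  · intro z
    rw [Diffeomorph.coe_refl, Function.comp_id]
    exact map_mfderiv_boundaryDataIncl_boundaryPlaneField S.J b z
  · rw [Diffeomorph.coe_refl]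
    exact h

/-- **Every compact Stein domain is a half of a Kähler decomposition**: a compact (Hausdorff,
second countable) Stein domain `W` with boundary datum `b` has a double `X = W ∪_{id} W` — a
closed (compact Hausdorff second-countable) smooth 4-manifold (existence of gluings,
`exists_isBoundaryGluing_holds`) — and every such double satisfies the conclusion of
`baykur_kahlerDecomposition` (`baykur_conclusion_of_isDouble`).
[cite: Baykur2006, §6 Example 2] -/
theorem exists_isDouble_and_baykur_conclusion [T2Space W]
    (S : SteinStructure W) (b : BoundaryData (𝓡∂ 4) W (𝓡 3)) :
    ∃ (X : Type) (_ : TopologicalSpace X) (_ : T2Space X) (_ : SecondCountableTopology X)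
      (_ : CompactSpace X) (_ : ChartedSpace (EuclideanSpace ℝ (Fin 4)) X)
      (_ : IsManifold (𝓡 4) ∞ X),
      IsDouble b (𝓡 4) X ∧
      ∃ (W₁ : Type) (_ : TopologicalSpace W₁) (_ : ChartedSpace (EuclideanHalfSpace 4) W₁)
        (_ : IsManifold (𝓡∂ 4) ∞ W₁) (_ : CompactSpace W₁)
        (W₂ : Type) (_ : TopologicalSpace W₂) (_ : ChartedSpace (EuclideanHalfSpace 4) W₂)
        (_ : IsManifold (𝓡∂ 4) ∞ W₂) (_ : CompactSpace W₂)
        (S₁ : SteinStructure W₁) (S₂ : SteinStructure W₂)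
        (b₁ : BoundaryData (𝓡∂ 4) W₁ (𝓡 3)) (b₂ : BoundaryData (𝓡∂ 4) W₂ (𝓡 3))
        (ψ : b₁.carrier ≃ₘ⟮𝓡 3, 𝓡 3⟯ b₂.carrier),
        (∀ z, Submodule.map (mfderiv (𝓡 3) (𝓡∂ 4) (b₂.incl ∘ ψ) z).toLinearMap
            (boundaryPlaneField S₁.J b₁ z) = contactPlane S₂.J (b₂.incl (ψ z))) ∧
          IsBoundaryGluing b₁ b₂ ψ (𝓡 4) X := by
  obtain ⟨X, tX, hX, sX, kX, cX, mX, hglue⟩ :=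
    exists_isBoundaryGluing_holds (bM := b) (bN := b) (Diffeomorph.refl (𝓡 3) b.carrier ∞)
  have hD : IsDouble b (𝓡 4) X := by
    have h' := hglue
    rw [Diffeomorph.coe_refl] at h'
    exact h'
  exact ⟨X, tX, hX, sX, kX, cX, mX, hD, baykur_conclusion_of_isDouble S b hD⟩

end Doubles

end Literature.Geometry.Symplectic

end
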